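import Mathlib
import Summits.ResolutionOfSingularities.ResolutionOfSingularities.Theorems.HomologicalConductorNoZenoSplittingBase
import HarnessLib

/-!
# The splitting base of a normal domain is a normal domain (BC-N♯)

W4.4 (crux `NoZenoR`, stmt-ResolutionOfSingularities-19943), brick **BC-N** of the base-change
package of route (F1) for `stub_L1wCore`, in the GLOBAL form needed by the upstairs thread data
(D2′ of the (L1)-prep note v2): if `A` is a normal (integrally closed) domain and `f ∈ A[X]` is monic,
irreducible over `Frac A`, with `f'` a unit in `B := A[X]/(f)` (equivalently: `f` has unit
discriminant), then `B` is a normal domain — indeed `B` is the integral closure of `A` in the field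
`L = Frac(A)[X]/(f)`.

Proof (classical, via the discriminant): `L` is a finite separable extension of `K = Frac A`
generated by a root `α` of `f`; for `z ∈ L` integral over `A`, `disc(f) · z ∈ A[α]` (Mathlib
`Algebra.discr_mul_isIntegral_mem_adjoin`); `disc(f) = ± N_{L/K}(f'(α))` (Mathlib
`Algebra.discr_powerBasis_eq_norm`) and `N(f'(α)) · N(f'(α)⁻¹) = 1` with both factors in `A`
(norms of `A`-integral elements, `A` integrally closed), so `disc(f)` is a unit of `A` and
`z ∈ A[α]`. Hence `A[α] ≅ A[X]/(f)` is the integral closure of `A` in `L`, a normal domain.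
Corollaries: the same with `f` irreducible over `A` (Gauss), and for the splitting base of BC-0 /
BC-0′ over a normal local domain (reduction irreducible and separable). Everything is PROVED; no
named facts.

OURS (cell res-hironaka, chain W4.4); AI-written, weaker than expert review; nothing here is a
statement of the manuscript under review.
-/

noncomputable section

set_option linter.dupNamespace false

open IsLocalRing Polynomial Algebra
open scoped IntermediateField

namespace Summit.ResolutionOfSingularities.ResolutionOfSingularities.Theorems.NoZeno.SplittingBase

universe u v

variable {A : Type u} [CommRing A] [IsDomain A] [IsIntegrallyClosed A]

/-- If `f'` is a unit modulo the monic `f`, then `f ⊗ K` is separable over any field `K` receiving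
`A`. [folklore] -/
theorem separable_map_of_isUnit_mk_derivative {A : Type u} [CommRing A] {K : Type*} [Field K]
    [Algebra A K] {f : A[X]} (hu : IsUnit (AdjoinRoot.mk f (derivative f))) :
    (f.map (algebraMap A K)).Separable := by
  obtain ⟨y, hy⟩ := hu.exists_right_inv
  obtain ⟨p, rfl⟩ := AdjoinRoot.mk_surjective y
  have hdvd : f ∣ derivative f * p - 1 := by
    rw [← AdjoinRoot.mk_eq_zero, map_sub, map_mul, hy, map_one, sub_self]
  obtain ⟨c, hc⟩ := hdvd
  -- `(-c) f + p f' = 1` in `A[X]`, hence after mapping to `K[X]`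
  refine ⟨(-c).map (algebraMap A K), p.map (algebraMap A K), ?_⟩
  rw [Polynomial.derivative_map, ← Polynomial.map_mul, ← Polynomial.map_mul,
    ← Polynomial.map_add, ← Polynomial.map_one (algebraMap A K)]
  congr 1
  linear_combination hc

/-- **BC-N♯.** Let `A` be an integrally closed domain with fraction field `K`, `f ∈ A[X]` monic with
`f ⊗ K` irreducible and `f'` a unit in `B := A[X]/(f)`. Then `B` is a domain and integrally
closed (it is the integral closure of `A` in `K[X]/(f)`). [folklore; e.g. the discriminant
criterion for monogenic orders] -/
theorem isDomain_and_isIntegrallyClosed_adjoinRoot {f : A[X]} (hf : f.Monic)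
    (hirr : Irreducible (f.map (algebraMap A (FractionRing A))))
    (hu : IsUnit (AdjoinRoot.mk f (derivative f))) :
    IsDomain (AdjoinRoot f) ∧ IsIntegrallyClosed (AdjoinRoot f) := by
  classical
  set K := FractionRing A with hK
  set fK : K[X] := f.map (algebraMap A K) with hfK
  have hfK_monic : fK.Monic := hf.map _
  have hfK0 : fK ≠ 0 := hfK_monic.ne_zero
  haveI : Fact (Irreducible fK) := ⟨hirr⟩
  -- the field `L = K[X]/(f)` and the root `α`
  set L := AdjoinRoot fK with hL
  set α : L := AdjoinRoot.root fK with hα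
  haveI : Module.Finite K L := (AdjoinRoot.powerBasis hfK0).finite
  have hαf : aeval α f = 0 := by
    rw [← Polynomial.aeval_map_algebraMap K α f]
    show aeval (AdjoinRoot.root fK) fK = 0
    rw [AdjoinRoot.aeval_eq, AdjoinRoot.mk_self]
  have hint : IsIntegral A α := ⟨f, hf, by rwa [← aeval_def]⟩
  -- separability of `L/K`
  have hsepK : fK.Separable := separable_map_of_isUnit_mk_derivative hu
  have hminK : minpoly K α = fK := by
    rw [hα]; exact (AdjoinRoot.minpoly_root hfK0).trans (by
      rw [hfK_monic.leadingCoeff, inv_one, C_1, mul_one])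
  haveI hsepL : Algebra.IsSeparable K L := by
    have hαsep : IsSeparable K α := by rw [IsSeparable, hminK]; exact hsepK
    haveI : Algebra.IsSeparable K K⟮α⟯ :=
      (IntermediateField.isSeparable_adjoin_simple_iff_isSeparable K L).mpr hαsep
    have htop : K⟮α⟯ = ⊤ := by
      rw [← IntermediateField.toSubalgebra_injective.eq_iff, IntermediateField.top_toSubalgebra]
      apply le_antisymm le_top
      rw [← AdjoinRoot.adjoinRoot_eq_top]
      exact IntermediateField.algebra_adjoin_le_adjoin K _
    let e : L ≃ₐ[K] K⟮α⟯ :=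
      (IntermediateField.topEquiv.symm).trans (IntermediateField.equivOfEq htop.symm)
    exact Algebra.IsSeparable.of_algHom K (K⟮α⟯) e.toAlgHom
  -- the embedding `φ : A[X]/(f) → L`, `root ↦ α`
  let φ : AdjoinRoot f →ₐ[A] L :=
    AdjoinRoot.liftAlgHom f (Algebra.ofId A L) α (by change aeval α f = 0; exact hαf)
  have hφmk : ∀ p : A[X], φ (AdjoinRoot.mk f p) = aeval α p := fun p => by
    simp only [φ, AdjoinRoot.liftAlgHom_mk]
    rfl
  -- every element of `A[X]/(f)` maps to an `A`-integral element of `L`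
  haveI : Module.Finite A (AdjoinRoot f) := hf.finite_adjoinRoot
  have hφint : ∀ x : AdjoinRoot f, IsIntegral A (φ x) := fun x =>
    (Algebra.IsIntegral.isIntegral x).map φ
  -- the norm of `f'(α)` is a unit of `A`
  set u : L := φ (AdjoinRoot.mk f (derivative f)) with hudef
  have hu' : IsUnit u := hu.map φ
  obtain ⟨v, hv⟩ := hu'.exists_right_inv
  have hvint : IsIntegral A v := by
    -- `v = φ (inverse)`
    obtain ⟨w, hw⟩ := hu.exists_right_inv
    have : v = φ w := by
      have h1 : u * φ w = 1 := by rw [hudef, ← map_mul, hw, map_one]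
      calc v = v * (u * φ w) := by rw [h1, mul_one]
        _ = (u * v) * φ w := by ring
        _ = φ w := by rw [hv, one_mul]
    rw [this]; exact hφint w
  obtain ⟨a, ha⟩ := (IsIntegrallyClosed.isIntegral_iff (R := A) (K := K)).mp
    (Algebra.isIntegral_norm K (hφint (AdjoinRoot.mk f (derivative f))))
  obtain ⟨b, hb⟩ := (IsIntegrallyClosed.isIntegral_iff (R := A) (K := K)).mp
    (Algebra.isIntegral_norm K hvint)
  have hab : a * b = 1 := by
    apply IsFractionRing.injective A K
    rw [map_mul, ha, hb, map_one, ← hudef, ← map_mul, hv, map_one]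
  have haunit : IsUnit a := IsUnit.of_mul_eq_one b hab
  -- the discriminant of the power basis `1, α, …, α^{n-1}` is `± N(f'(α))`
  let pb : PowerBasis K L := AdjoinRoot.powerBasis hfK0
  have hpbgen : pb.gen = α := rfl
  have hdisc : Algebra.discr K pb.basis =
      (-1) ^ (Module.finrank K L * (Module.finrank K L - 1) / 2) * algebraMap A K a := by
    rw [Algebra.discr_powerBasis_eq_norm, hpbgen, hminK, ha]
    congr 2
    rw [hφmk]
    show aeval α (derivative (f.map (algebraMap A K))) = aeval α (derivative f)
    rw [Polynomial.derivative_map, Polynomial.aeval_map_algebraMap]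
  -- every `A`-integral element of `L` lies in `A[α]`
  have hclosed : ∀ z : L, IsIntegral A z → z ∈ Algebra.adjoin A ({α} : Set L) := by
    intro z hz
    have hmem := Algebra.discr_mul_isIntegral_mem_adjoin K (B := pb) (hpbgen ▸ hint) hz
    rw [hpbgen] at hmem
    rw [hdisc] at hmem
    -- remove the sign and the unit `a`: multiply by `(-1)^k · a⁻¹ ∈ A`
    obtain ⟨a', ha'⟩ := haunit.exists_left_inv
    set k : ℕ := Module.finrank K L * (Module.finrank K L - 1) / 2 with hk
    have hinv : algebraMap A K ((-1) ^ k * a') * ((-1) ^ k * algebraMap A K a) = 1 := by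
      have h1 : algebraMap A K a' * algebraMap A K a = 1 := by rw [← map_mul, ha', map_one]
      rw [map_mul, map_pow, map_neg, map_one, mul_mul_mul_comm, ← mul_pow, neg_one_mul, neg_neg,
        one_pow, one_mul, h1]
    have hz : z = ((-1 : A) ^ k * a') • (((-1 : K) ^ k * algebraMap A K a) • z) := by
      rw [← algebraMap_smul K ((-1 : A) ^ k * a'), ← mul_smul, hinv, one_smul]
    rw [hz]
    exact Subalgebra.smul_mem _ hmem _
  -- `A[α]` is the integral closure of `A` in `L`
  have hadj : Algebra.adjoin A ({α} : Set L) = integralClosure A L := by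
    apply le_antisymm (adjoin_le_integralClosure hint)
    intro z hz
    exact hclosed z hz
  -- `A[X]/(f) ≃ A[α]`
  have hmin : minpoly A α = f := by
    have h1 : (minpoly A α).map (algebraMap A K) = f.map (algebraMap A K) := by
      rw [← minpoly.isIntegrallyClosed_eq_field_fractions' K hint, hminK]
    exact Polynomial.map_injective _ (IsFractionRing.injective A K) h1
  haveI : FaithfulSMul A L := (faithfulSMul_iff_algebraMap_injective A L).mpr (by
    rw [IsScalarTower.algebraMap_eq A K L]
    exact (algebraMap K L).injective.comp (IsFractionRing.injective A K))
  let e : AdjoinRoot f ≃ₐ[A] Algebra.adjoin A ({α} : Set L) :=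
    (Ideal.quotientEquivAlgOfEq A (by rw [hmin])).trans (minpoly.equivAdjoin hint)
  -- conclude
  haveI : IsIntegrallyClosed (integralClosure A L) :=
    integralClosure.isIntegrallyClosedOfFiniteExtension K
  haveI hic : IsIntegrallyClosed (Algebra.adjoin A ({α} : Set L)) :=
    IsIntegrallyClosed.of_equiv (Subalgebra.equivOfEq _ _ hadj.symm).toRingEquiv
  exact ⟨Function.Injective.isDomain e.toRingEquiv.toRingHom e.injective,
    IsIntegrallyClosed.of_equiv e.symm.toRingEquiv⟩

/-- **BC-N♯, irreducibility over `A`.** For a normal domain `A` and `f ∈ A[X]` monic, irreducible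
over `A`, with `f'` a unit modulo `f`: `A[X]/(f)` is a normal domain (Gauss: irreducible over
`Frac A`). [folklore] -/
theorem isDomain_and_isIntegrallyClosed_adjoinRoot_of_irreducible {f : A[X]} (hf : f.Monic)
    (hirr : Irreducible f) (hu : IsUnit (AdjoinRoot.mk f (derivative f))) :
    IsDomain (AdjoinRoot f) ∧ IsIntegrallyClosed (AdjoinRoot f) :=
  isDomain_and_isIntegrallyClosed_adjoinRoot hf
    ((hf.irreducible_iff_irreducible_map_fraction_map (K := FractionRing A)).mp hirr) hu

/-- **BC-N for the splitting base (BC-0 / BC-0′ shape).** Over a normal LOCAL domain `A`, if the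
monic `f ∈ A[X]` has irreducible and separable reduction modulo `𝔪_A`, then the splitting base
`B = A[X]/(f)` is a normal domain. (Irreducible over `A` by `Polynomial.Monic.irreducible_of_irreducible_map`
applied to the residue map; `f'` a unit by `isUnit_mk_derivative_of_separable_map`.) [folklore] -/
theorem isDomain_and_isIntegrallyClosed_adjoinRoot_of_residue [IsLocalRing A] {f : A[X]}
    (hf : f.Monic) (hirr : Irreducible (f.map (residue A)))
    (hsep : (f.map (residue A)).Separable) :
    IsDomain (AdjoinRoot f) ∧ IsIntegrallyClosed (AdjoinRoot f) :=
  isDomain_and_isIntegrallyClosed_adjoinRoot_of_irreducible hf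
    (hf.irreducible_of_irreducible_map (residue A) f hirr)
    (isUnit_mk_derivative_of_separable_map hf hsep)

/-- **The splitting base of a normal Noetherian local domain, with normality.** BC-0 re-run with
the extra conclusion: for `A` a normal Noetherian local domain and `κ₁/κ_A` finite separable there
is a monic `f` (the lift of the minimal polynomial of a primitive element, so with irreducible
separable reduction) such that `B := A[X]/(f)` is a normal local domain, finite free and étale
over `A`, `A → B` local with `𝔪_A·B = 𝔪_B`, and `κ_B ≃ₐ[κ_A] κ₁`. [folklore] -/
theorem exists_adjoinRoot_normal_splittingBase (A : Type u) [CommRing A] [IsDomain A]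
    [IsIntegrallyClosed A] [IsLocalRing A] [IsNoetherianRing A]
    (κ₁ : Type v) [Field κ₁] [Algebra (ResidueField A) κ₁]
    [FiniteDimensional (ResidueField A) κ₁] [Algebra.IsSeparable (ResidueField A) κ₁] :
    ∃ f : A[X], f.Monic ∧ f.natDegree = Module.finrank (ResidueField A) κ₁ ∧
      Irreducible (f.map (residue A)) ∧ (f.map (residue A)).Separable ∧
      IsDomain (AdjoinRoot f) ∧ IsIntegrallyClosed (AdjoinRoot f) ∧
      ∃ (_ : IsLocalRing (AdjoinRoot f)) (_ : IsLocalHom (algebraMap A (AdjoinRoot f))),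
        IsNoetherianRing (AdjoinRoot f) ∧ Module.Free A (AdjoinRoot f) ∧
        Module.Finite A (AdjoinRoot f) ∧ Algebra.Etale A (AdjoinRoot f) ∧
        (maximalIdeal A).map (algebraMap A (AdjoinRoot f)) = maximalIdeal (AdjoinRoot f) ∧
        Nonempty (ResidueField (AdjoinRoot f) ≃ₐ[ResidueField A] κ₁) := by
  classical
  set κ := ResidueField A with hκ
  -- primitive element, minimal polynomial, monic lift (as in BC-0)
  obtain ⟨α, hα⟩ := Field.exists_primitive_element κ κ₁
  have hint : IsIntegral κ α := IsIntegral.of_finite κ α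
  set g : κ[X] := minpoly κ α with hg
  have hg_monic : g.Monic := minpoly.monic hint
  have hg_sep : g.Separable := Algebra.IsSeparable.isSeparable κ α
  have hg_irr : Irreducible g := minpoly.irreducible hint
  have hg_deg : g.natDegree = Module.finrank κ κ₁ := by
    rw [hg, ← IntermediateField.adjoin.finrank hint, hα, IntermediateField.finrank_top']
  obtain ⟨f, hf_map, hf_deg, hf_monic⟩ :=
    Polynomial.lifts_and_natDegree_eq_and_monic
      (Polynomial.mem_lifts_of_surjective (f := residue A) residue_surjective g) hg_monic
  have hirr : Irreducible (f.map (residue A)) := by rw [hf_map]; exact hg_irr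
  have hsep : (f.map (residue A)).Separable := by rw [hf_map]; exact hg_sep
  -- normality
  obtain ⟨hdom, hic⟩ := isDomain_and_isIntegrallyClosed_adjoinRoot_of_residue hf_monic hirr hsep
  -- the BC-0 package, re-derived for THIS `f`
  haveI hfree : Module.Free A (AdjoinRoot f) := hf_monic.free_adjoinRoot
  haveI hfin : Module.Finite A (AdjoinRoot f) := hf_monic.finite_adjoinRoot
  haveI : Algebra.IsStandardEtale A (AdjoinRoot f) :=
    isStandardEtale_adjoinRoot_of_separable_map hf_monic hsep
  haveI het : Algebra.Etale A (AdjoinRoot f) := inferInstance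
  -- `B/𝔪B ≃ κ[X]/(g)` is a field ⇒ local, `𝔪_A B = 𝔪_B`
  haveI : Fact (Irreducible g) := ⟨hg_irr⟩
  have hspan : (Ideal.span {Polynomial.map (residue A) f} : Ideal κ[X]) = Ideal.span {g} := by
    rw [hf_map]
  let E₁ : (AdjoinRoot f ⧸ Ideal.map (AdjoinRoot.of f) (maximalIdeal A)) ≃ₐ[A] AdjoinRoot g :=
    (AdjoinRoot.quotEquivQuotMap f (maximalIdeal A)).trans (Ideal.quotientEquivAlgOfEq A hspan)
  have hmax : (Ideal.map (AdjoinRoot.of f) (maximalIdeal A)).IsMaximal :=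
    Ideal.Quotient.maximal_of_isField _
      (MulEquiv.isField (Field.toIsField (AdjoinRoot g)) E₁.toMulEquiv)
  have halg : algebraMap A (AdjoinRoot f) = AdjoinRoot.of f := AdjoinRoot.algebraMap_eq f
  have hmax' : ((maximalIdeal A).map (algebraMap A (AdjoinRoot f))).IsMaximal := by
    rw [halg]; exact hmax
  haveI hloc : IsLocalRing (AdjoinRoot f) := isLocalRing_of_isMaximal_map hmax'
  have hmB' : (maximalIdeal A).map (algebraMap A (AdjoinRoot f)) = maximalIdeal (AdjoinRoot f) :=
    maximalIdeal_eq_map_of_isMaximal_map hmax'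
  have hmB : Ideal.map (AdjoinRoot.of f) (maximalIdeal A) = maximalIdeal (AdjoinRoot f) := by
    rw [← halg]; exact hmB'
  haveI hlh : IsLocalHom (algebraMap A (AdjoinRoot f)) := isLocalHom_of_map_le hmB'.le
  haveI hN : IsNoetherianRing (AdjoinRoot f) := IsNoetherianRing.of_finite A (AdjoinRoot f)
  -- residue field
  letI : Algebra A κ₁ := ((algebraMap κ κ₁).comp (algebraMap A κ)).toAlgebra
  haveI : IsScalarTower A κ κ₁ := IsScalarTower.of_algebraMap_eq (fun _ => rfl)
  let E₂ : AdjoinRoot g ≃ₐ[κ] κ₁ :=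
    (IntermediateField.adjoinRootEquivAdjoin κ hint).trans
      ((IntermediateField.equivOfEq hα).trans IntermediateField.topEquiv)
  let E₀ : ResidueField (AdjoinRoot f) ≃ₐ[A]
      (AdjoinRoot f ⧸ Ideal.map (AdjoinRoot.of f) (maximalIdeal A)) :=
    Ideal.quotientEquivAlgOfEq A hmB.symm
  let E : ResidueField (AdjoinRoot f) ≃ₐ[A] κ₁ := (E₀.trans E₁).trans (E₂.restrictScalars A)
  have hsurj : Function.Surjective (algebraMap A κ) := residue_surjective
  exact ⟨f, hf_monic, by rw [hf_deg, hg_deg], hirr, hsep, hdom, hic, hloc, hlh, hN, hfree, hfin,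
    het, hmB', ⟨AlgEquiv.extendScalarsOfSurjective hsurj E⟩⟩

/-! ## (2b-0) The deterministic BC-0: a GIVEN monic `f` with irreducible reduction over a local ring

For the upstairs thread data (D2′) the polynomial `f` is fixed in advance (chosen downstairs); these
lemmas give the local structure of `A[X]/(f)` for that `f` — the statements hidden inside the
existential proofs of `exists_adjoinRoot_isLocalRing_etale_residueField_algEquiv` /
`exists_adjoinRoot_normal_splittingBase`. -/

section GivenPolynomial

variable {A : Type u} [CommRing A] [IsLocalRing A]

/-- If the reduction `f̄ ∈ κ_A[X]` of `f` is irreducible then `𝔪_A·(A[X]/(f))` is a maximal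
ideal. [folklore] -/
theorem isMaximal_map_maximalIdeal_adjoinRoot_of_irreducible {f : A[X]}
    (hirr : Irreducible (f.map (residue A))) :
    ((maximalIdeal A).map (algebraMap A (AdjoinRoot f))).IsMaximal := by
  haveI : Fact (Irreducible (f.map (residue A))) := ⟨hirr⟩
  -- `A[X]/(f) ⧸ 𝔪_A ≃ₐ[A] κ_A[X]/(f̄)` (Mathlib `AdjoinRoot.quotEquivQuotMap`, up to the spelling of `κ_A`)
  let E : (AdjoinRoot f ⧸ Ideal.map (AdjoinRoot.of f) (maximalIdeal A)) ≃ₐ[A]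
      AdjoinRoot (f.map (residue A)) :=
    AdjoinRoot.quotEquivQuotMap f (maximalIdeal A)
  rw [AdjoinRoot.algebraMap_eq]
  exact Ideal.Quotient.maximal_of_isField _
    (MulEquiv.isField (Field.toIsField (AdjoinRoot (f.map (residue A)))) E.toMulEquiv)

/-- **BC-0 for a given `f`**: over a local ring `A`, if `f` is monic with irreducible reduction then
`A[X]/(f)` is local, `A → A[X]/(f)` is a local homomorphism and `𝔪_A·(A[X]/(f))` is its maximal
ideal. [folklore] -/
theorem adjoinRoot_isLocalRing_of_irreducible {f : A[X]} (hf : f.Monic)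
    (hirr : Irreducible (f.map (residue A))) :
    ∃ (_ : IsLocalRing (AdjoinRoot f)) (_ : IsLocalHom (algebraMap A (AdjoinRoot f))),
      (maximalIdeal A).map (algebraMap A (AdjoinRoot f)) = maximalIdeal (AdjoinRoot f) := by
  haveI := hf.finite_adjoinRoot
  have hmax := isMaximal_map_maximalIdeal_adjoinRoot_of_irreducible (f := f) hirr
  haveI hloc : IsLocalRing (AdjoinRoot f) := isLocalRing_of_isMaximal_map hmax
  have hmB : (maximalIdeal A).map (algebraMap A (AdjoinRoot f)) = maximalIdeal (AdjoinRoot f) :=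
    maximalIdeal_eq_map_of_isMaximal_map hmax
  exact ⟨hloc, isLocalHom_of_map_le hmB.le, hmB⟩

/-- In the situation of `adjoinRoot_isLocalRing_of_irreducible`, an element of `A[X]/(f)` is a unit
iff its reduction in `κ_A[X]/(f̄)` is nonzero. [folklore] -/
theorem isUnit_adjoinRoot_iff_of_irreducible {f : A[X]} (hf : f.Monic)
    (hirr : Irreducible (f.map (residue A))) (x : AdjoinRoot f) :
    IsUnit x ↔ Ideal.Quotient.mk (Ideal.map (AdjoinRoot.of f) (maximalIdeal A)) x ≠ 0 := by
  obtain ⟨hloc, -, hmB⟩ := adjoinRoot_isLocalRing_of_irreducible hf hirr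
  rw [Ne, Ideal.Quotient.eq_zero_iff_mem, ← AdjoinRoot.algebraMap_eq, hmB]
  exact (IsLocalRing.notMem_maximalIdeal).symm

end GivenPolynomial

/-! ## (2b-i) Normality of the upstairs model `T_f`

`res-L0-w44-stub-2`'s `exists_splitModel` realises `T[X]/(f)` as a `k`-subalgebra `T_f` of the
enlarged function field `K_f = K[X]/(f_K)` via `e : AdjoinRoot f ≃ₐ[k] T_f`; BC-N♯ transports along `e`. -/

/-- **The upstairs model is a normal domain**: if `T` is a normal domain, `f ∈ T[X]` is monic and
irreducible over `T` (equivalently over `Frac T`, Gauss) and `f'` is a unit modulo `f`, then any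
ring `T_f` isomorphic to `T[X]/(f)` — in particular the split model inside `K[X]/(f_K)` — is an
integrally closed domain. [folklore] -/
theorem isIntegrallyClosed_of_equiv_adjoinRoot {T : Type u} [CommRing T] [IsDomain T]
    [IsIntegrallyClosed T] {f : T[X]} (hf : f.Monic) (hirr : Irreducible f)
    (hu : IsUnit (AdjoinRoot.mk f (derivative f))) {Tf : Type*} [CommRing Tf]
    (e : AdjoinRoot f ≃+* Tf) : IsDomain Tf ∧ IsIntegrallyClosed Tf := by
  obtain ⟨hdom, hic⟩ := isDomain_and_isIntegrallyClosed_adjoinRoot_of_irreducible hf hirr hu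
  exact ⟨Function.Injective.isDomain e.symm.toRingHom e.symm.injective,
    IsIntegrallyClosed.of_equiv e⟩

end Summit.ResolutionOfSingularities.ResolutionOfSingularities.Theorems.NoZeno.SplittingBase

end
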